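import Summits.BirchSwinnertonDyer.Rank1Residual.Additive.XGssRankZeroCyclotomicThree
import Summits.BirchSwinnertonDyer.Rank1Residual.Additive.RamifiedTwistMinimality
import Literature.NumberTheory.EllipticCurves.BSDSelmerParityDokchitserBaseChangeProofs
import Literature.NumberTheory.EllipticCurves.BSDInvariantsProofs
import HarnessLib

/-!
# X4 at `p = 3`, SUPERSINGULAR twist (line V18♯): the ℚ-SIDE form
# `ord₃#Ш(V) + ord₃#Ш(W) + 2 ord₃(#V(ℚ)·#W(ℚ)) ≤ ord₃#Ш_an(V) + ord₃#Ш_an(W) + ord₃(∏c(V)·∏c(W))`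
# — Milne's identity replaced by the quadratic Selmer comparison isomorphism (no `K`-side datum)

HONEST FRAMING (cell `b2b-bsdres`, run/shared/lean/b2b/bsd-rank1-residual/, verbatim in every
file): the goal of the cell is to DELETE the COMBINATION-SHAPED residual classes of the
Birch–Swinnerton-Dyer formula for ALL analytic-rank `≤ 1` elliptic curves over `ℚ` — "full BSD
formula for every rank `≤ 1` curve in class `C`" assembled STRICTLY from published theorems — so
that the rank-`≤ 1` remainder becomes exactly the CONSTRUCTION-SHAPED classes, which are TYPED
(missing-input `Prop`s), NOT attempted. This is not "finishing BSD". Seat additive-p4 (research route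
on X3/X4); the label of X4 is UNCHANGED by this file; nothing is booked here.

Theorems only (no `def`, no `sorry`, no new named fact). Sharpening of
`XGssRankZeroCyclotomicThree.lean` (line V18): there the bottom-layer control INEQUALITY
`ord₃ #Sel_{3^∞}(V_K/K) ≤ ord₃ f⁺(0)` was combined with MILNE's Weil-restriction identity, which —
an inequality carrying no Tamagawa term over `K` to cancel — leaves `+ ord₃ ∏_w c_w(V_K)`
(`K = ℚ(ζ₃)`) as a per-row datum. Here Milne is REPLACED by the tree's quadratic Selmer comparison
(Dokchitser–Dokchitser 2010, proof of Lemma 4.14, PROVED in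
`Literature/…/BSDSelmerParityDokchitserBaseChangeProofs.lean`):
`Φ : Sel_{p^∞}(V/ℚ) × Sel_{p^∞}(V^{(c)}/ℚ) → Sel_{p^∞}(V_K/K)`, `K = ℚ(√c)`, has kernel and cokernel
killed by `8` (`nsmul_eq_zero_of_comparisonMap_eq_zero`, `nsmul_mem_range_comparisonMap`), hence is
a BIJECTION on these `3`-primary groups: `#Sel_{3^∞}(V_K) = #Sel_{3^∞}(V) · #Sel_{3^∞}(V^{(−3)})`,
and in rank `0` the right-hand side is `#Ш(V)[3^∞] · #Ш(W)[3^∞]` (`Ш` is a model invariant,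
`shaEquiv`). The analytic side is unchanged (Kobayashi Thm. 4.1 / (3.6), Birch, Pal:
`v(g(0)) = v(L(V,1)/Ω_V) + v(ϖ'S⁻)` and `ord₃ u(C) = 0`, `padicValRat_u_eq_zero_of_twist_pm_p`), so

  **`ord₃#Ш(V) + ord₃#Ш(W) + 2(ord₃#V(ℚ) + ord₃#W(ℚ)) ≤ ord₃#Ш_an(V) + ord₃#Ш_an(W) + ord₃∏c(V) + ord₃∏c(W)`**

— every term a ℚ-side census quantity (no Tamagawa numbers or torsion over `K`, no Milne fact).
Corollaries (facts-only, census bits `surj(3)`, `ram(3)` of `W`): on the rows with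
`3 ∤ #Ш_an(V)·#Ш_an(W)·∏c(V)·∏c(W)` — 12 of the 18 CORE rows of `V18-CENSUS.tsv`, 11 with a (ram)
prime — **`BSD(W,3) ∧ BSD(V,3)`** from Kobayashi 2003, Kitajima–Otsuki 2018, Pollack 2003,
modularity and GZK alone (`XGssCyclotomicThreeSharp.bsdp_of_units_of_surj_of_ram`,
`ClassX4.bsdp_three_of_ssTwist_of_units`).
-/

noncomputable section

open scoped Classical MatrixGroups ModularForm

open CongruenceSubgroup WeierstrassCurve NumberField IsDedekindDomain
  Literature.NumberTheory.EllipticCurves Literature.NumberTheory.EllipticCurves.ModularForms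
  Literature.NumberTheory.EllipticCurves.Rank1Residual
  Literature.NumberTheory.EllipticCurves.Rank1Residual.Typed
  Literature.NumberTheory.EllipticCurves.Kobayashi2003
  Literature.NumberTheory.GaloisRepresentations

namespace Summit.BirchSwinnertonDyer.Rank1Residual.Additive

/-! ## §0 Coprime-torsion bookkeeping -/

/-- An element killed by two coprime naturals is zero. [folklore] -/
theorem XGssCyclotomicThreeSharp.eq_zero_of_nsmul_eq_zero_of_coprime {G : Type*} [AddCommGroup G]
    {m n : ℕ} (h : Nat.Coprime m n) {x : G} (hm : m • x = 0) (hn : n • x = 0) : x = 0 := by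
  obtain ⟨a, b, hab⟩ := Nat.isCoprime_iff_coprime.mpr h
  have h1 : ((a * m + b * n : ℤ)) • x = x := by rw [hab, one_zsmul]
  rw [← h1, add_zsmul, mul_zsmul, mul_zsmul, natCast_zsmul, natCast_zsmul, hm, hn, zsmul_zero,
    zsmul_zero, add_zero]

/-- An element `s` with `n • s = 0` is an integer multiple of `m • s` when `m`, `n` are coprime.
[folklore] -/
theorem XGssCyclotomicThreeSharp.exists_zsmul_nsmul_eq_of_coprime {G : Type*} [AddCommGroup G]
    {m n : ℕ} (h : Nat.Coprime m n) {s : G} (hn : n • s = 0) : ∃ a : ℤ, a • (m • s) = s := by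
  obtain ⟨a, b, hab⟩ := Nat.isCoprime_iff_coprime.mpr h
  refine ⟨a, ?_⟩
  have h1 : ((a * m + b * n : ℤ)) • s = s := by rw [hab, one_zsmul]
  conv_rhs => rw [← h1]
  rw [add_zsmul, mul_zsmul, mul_zsmul, natCast_zsmul, natCast_zsmul, hn, zsmul_zero, add_zero]

/-! ## §1 The sharp core theorem -/

section Core

variable (K : Type) [Field K] [NumberField K] [IsCyclotomicExtension {3} ℚ K]
  (V : WeierstrassCurve ℚ) [V.IsElliptic] [V.IsGloballyMinimal]
  (W : WeierstrassCurve ℚ) [W.IsElliptic] [W.IsGloballyMinimal]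

/-- **Sharp core theorem (line V18♯, `p = 3`, rank `0 + 0`, supersingular twist, ℚ-side form).**
Same situation and Iwasawa-theoretic hypotheses as
`XGssRankZeroCyclotomicThree.exists_padicVal_shaOrder_add_le` (`V/ℚ` globally minimal, good at `3`
with `a₃(V) = 0`; `W = C • V^{(−3)}` globally minimal additive at `3`; ranks `(0,0)`; `f`, `ϖ`, `ϖ'`,
`L = L₃⁺(V,X)`; `hexK`, `hBK`, `hKobK` = Kobayashi Thm. 4.1/2.2/3.2 over `K = ℚ(ζ₃)`, `hnfK` =
Kitajima–Otsuki), but WITHOUT Milne: the quadratic Selmer comparison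
`Sel_{3^∞}(V/ℚ) × Sel_{3^∞}(V^{(−3)}/ℚ) ≅ Sel_{3^∞}(V_K/K)` (Dokchitser–Dokchitser, kernel and cokernel
killed by `8`, a bijection on `3`-primary groups) gives `#Ш(V)[3^∞]·#Ш(W)[3^∞] = #Sel_{3^∞}(V_K)`,
whence, with GZK (`hGZK`) and modularity (`hmod`): `#Ш_an(V) = q_V`, `#Ш_an(W) = q_W` and
**`ord₃#Ш(V) + ord₃#Ш(W) + 2(ord₃#V(ℚ) + ord₃#W(ℚ)) ≤ ord₃ q_V + ord₃ q_W + ord₃ ∏c(V) + ord₃ ∏c(W)`**.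
[cite: Kobayashi2003, Thm. 4.1 (p. 8), (3.6) (p. 7), Lemma 9.1 (p. 25)] [cite: KitajimaOtsuki2018, Main Thm. 1.3]
[cite: DokchitserDokchitserAnnals2010, Lemma 4.14 (proof)] [cite: GreenbergLNM1716, §4 Lemma 4.2 (p. 102)] -/
theorem XGssRankZeroCyclotomicThree.exists_padicVal_shaOrder_add_le_sharp
    (hGZK : rank_eq_analyticRank_of_analyticRank_le_one) (hmod : hasEntireLFunction_rat)
    (C : VariableChange ℚ) (hC : C • V.quadraticTwist (-(3 : ℚ)) = W)
    (hgood : V.HasGoodReductionAtPrime 3) (ha3 : V.frobeniusTrace 3 = 0) (hadd : Addv W 3)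
    (hrV : V.analyticRank = 0) (hrW : W.analyticRank = 0)
    {N : ℕ} [NeZero N] {f : CuspForm (Gamma0 N) 2} (hf : IsNewformOf V f)
    (ϖ ϖ' : ℚ) (hϖ : (ϖ : ℝ) * V.realPeriodRat = plusPeriod f)
    (hϖ' : (ϖ' : ℝ) * V.imaginaryPeriodRat = minusPeriod f)
    (L : IwasawaAlgebra 3) (hL : IsSignedPAdicLFunction f 3 1 L)
    (hexK : ∃ κ : ZpExtension K 3, κ.IsCyclotomic ∧ ∃ γ : Field.absoluteGaloisGroup K,
      κ.IsTopGenerator γ ∧ ∃ ζ : ℤ_[3]ˣ, IsOfFinOrder ζ ∧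
        ((GaloisRep.cyclotomicCharacter K 3 γ * ζ : ℤ_[3]ˣ) : ℤ_[3]) = (cyclotomicGenerator 3 : ℤ_[3]))
    (hBK : ∀ κ : ZpExtension K 3,
      FixedPoints.addSubgroup κ.kerSubgroup ((V.baseChange K).geomPrimaryTorsion 3) = ⊥)
    (hKobK : ∀ (κ : ZpExtension K 3) (γ : Field.absoluteGaloisGroup K),
      κ.IsCyclotomic → κ.IsTopGenerator γ →
      (∃ ζ : ℤ_[3]ˣ, IsOfFinOrder ζ ∧
        ((GaloisRep.cyclotomicCharacter K 3 γ * ζ : ℤ_[3]ˣ) : ℤ_[3]) = (cyclotomicGenerator 3 : ℤ_[3])) →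
      ∀ D : SignedSelmerDualData (V.baseChange K) κ γ 1,
        Module.Finite (IwasawaAlgebra 3) D.X ∧ Module.IsTorsion (IwasawaAlgebra 3) D.X ∧
        ∃ Lω : PowerSeries ℚ_[3],
          (∃ e : ℤ_[3]ˣ, PowerSeries.constantCoeff Lω =
            ((e : ℤ_[3]) : ℚ_[3]) * ((legendreMinusSymbolSum f 3 : ℚ) : ℚ_[3])) ∧
          ∃ g ∈ D.charIdeal, ∃ u : ℤ_[3]ˣ,
            iwasawaToPowerSeries 3 g =
              PowerSeries.C (((u : ℤ_[3]) : ℚ_[3]) * (ϖ : ℚ_[3]) * (ϖ' : ℚ_[3])) *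
                (iwasawaToPowerSeries 3 L * Lω))
    (hnfK : ∀ (κ : ZpExtension K 3) (γ : Field.absoluteGaloisGroup K),
      κ.IsCyclotomic → κ.IsTopGenerator γ →
      ∀ (D : SignedSelmerDualData (V.baseChange K) κ γ 1) [Module.Finite (IwasawaAlgebra 3) D.X],
        Module.IsTorsion (IwasawaAlgebra 3) D.X →
        ∀ N' : Submodule (IwasawaAlgebra 3) D.X, Finite N' → N' = ⊥) :
    ∃ qV qW : ℚ, shaAn V = (qV : ℂ) ∧ shaAn W = (qW : ℂ) ∧
      (padicValNat 3 V.shaOrder : ℤ) + padicValNat 3 W.shaOrder +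
          2 * (padicValNat 3 (Nat.card V.toAffine.Point) + padicValNat 3 (Nat.card W.toAffine.Point)) ≤
        padicValRat 3 qV + padicValRat 3 qW +
          padicValNat 3 V.tamagawaProduct + padicValNat 3 W.tamagawaProduct := by
  classical
  set p : ℕ := 3 with hp3
  -- §0 facts about `K`
  have h2 : Module.finrank ℚ K = 2 := finrank_eq_two_of_isCyclotomicExtension_three (K := K)
  have hdK : (NumberField.discr K : ℚ) = -(3 : ℚ) := by
    rw [discr_cyclotomicThree K]; norm_num
  haveI : IsTotallyComplex K := isTotallyComplex_cyclotomicThree K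
  have hC' : C • V.quadraticTwist (NumberField.discr K : ℚ) = W := by rw [hdK]; exact hC
  -- rank 0: `L(·,1) ≠ 0`, Mordell–Weil groups and `Ш` finite
  have hLV : V.entireLFunction 1 ≠ 0 := (V.analyticRank_eq_zero_iff_holds (hmod V)).mp hrV
  have hLW : W.entireLFunction 1 ≠ 0 := (W.analyticRank_eq_zero_iff_holds (hmod W)).mp hrW
  obtain ⟨hmwV, hfinV⟩ := hGZK V (by rw [hrV]; exact zero_le_one)
  obtain ⟨hmwW, hfinW⟩ := hGZK W (by rw [hrW]; exact zero_le_one)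
  haveI : Finite V.sha := hfinV
  haveI : Finite W.sha := hfinW
  haveI hEV : Finite V.toAffine.Point := V.finite_point_of_rank_zero (by rw [hmwV, hrV])
  haveI hEW : Finite W.toAffine.Point := W.finite_point_of_rank_zero (by rw [hmwW, hrW])
  -- the canonical `K`-model `V ⊗ K`
  set VK := V.baseChange K with hVK
  haveI hEK : Finite VK.toAffine.Point := finite_point_baseChange_of_twist K V W h2 hC'
  -- the cyclotomic setting over `K`, the signed Iwasawa module `X⁺(V/K_∞)`
  obtain ⟨κ, hκ, γ, hγ, hγ'⟩ := hexK
  obtain ⟨D⟩ := nonempty_signedSelmerDualData VK κ 1 hγ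
  -- Kobayashi over `K`
  obtain ⟨hfinX, hX, Lω, ⟨e, hLω⟩, g, hgmem, u, hιg⟩ := hKobK κ γ hκ hγ hγ' D
  haveI : Module.Finite (IwasawaAlgebra p) D.X := hfinX
  haveI : (Module.charIdeal (IwasawaAlgebra p) D.X).IsPrincipal := charIdeal_isPrincipal_holds p D.X
  obtain ⟨fE, hchar⟩ := Submodule.IsPrincipal.principal (Module.charIdeal (IwasawaAlgebra p) D.X)
  have hchar' : D.charIdeal = Ideal.span {fE} := hchar
  have hgmem' : g ∈ Ideal.span {fE} := by rw [← hchar']; exact hgmem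
  obtain ⟨h, hgh⟩ := Ideal.mem_span_singleton'.mp hgmem'
  -- the analytic side over `ℚ` for `V`: `t_V = ϖ [0]⁺_f = L(V,1)/Ω_V`
  set sV : ℚ := ratPlusSymbol f 0 with hsV
  set tV : ℚ := ϖ * sV with htV
  have hΩV : (V.realPeriodRat : ℂ) ≠ 0 := by exact_mod_cast V.realPeriodRat_pos_holds.ne'
  have hLvalV : V.entireLFunction 1 = (((sV : ℝ) * plusPeriod f : ℝ) : ℂ) := hf.entireLFunction_one_eq
  have hqV' : V.entireLFunction 1 / (V.realPeriodRat : ℂ) = ((tV : ℚ) : ℂ) := by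
    rw [hLvalV, ← hϖ, div_eq_iff hΩV, htV]
    push_cast
    ring
  have htV0 : tV ≠ 0 := by
    intro h0
    apply hLV
    have := (div_eq_iff hΩV).mp hqV'
    rw [this, h0]
    simp
  obtain ⟨-, -, -, hshaV⟩ := Wuthrich2014.shaAn_eq_of_L_one_div_eq hGZK V hLV hqV'
  -- the analytic side over `ℚ` for `W`: odd Birch + Pal
  obtain ⟨ε, hε, hLW_eq⟩ :=
    entireLFunction_one_eq_of_twist_neg 3 hmod (by norm_num) V W C hC hadd hf ϖ' hϖ'
  set S : ℚ := legendreMinusSymbolSum f 3 with hS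
  set cinf : ℕ := (W.baseChange ℝ).numRealComponents with hcinf
  set tW : ℚ := ε * (ϖ' * S) / (|(C.u : ℚ)| * (cinf : ℚ)) with htW
  have hΩW : (W.realPeriodRat : ℂ) ≠ 0 := by exact_mod_cast W.realPeriodRat_pos_holds.ne'
  have hqW' : W.entireLFunction 1 / (W.realPeriodRat : ℂ) = (tW : ℂ) := by
    rw [hLW_eq, mul_div_cancel_right₀ _ hΩW]
  obtain ⟨-, -, -, hshaW⟩ := Wuthrich2014.shaAn_eq_of_L_one_div_eq hGZK W hLW hqW'
  have hua0 : |(C.u : ℚ)| ≠ 0 := abs_ne_zero.mpr C.u.ne_zero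
  have hcinf0 : (cinf : ℚ) ≠ 0 := by
    rw [hcinf, numRealComponents]
    split_ifs <;> norm_num
  have hden0 : |(C.u : ℚ)| * (cinf : ℚ) ≠ 0 := mul_ne_zero hua0 hcinf0
  have hϖS : ϖ' * S ≠ 0 := by
    intro h0
    apply hLW
    rw [hLW_eq, htW, h0, mul_zero, zero_div, Rat.cast_zero, zero_mul]
  have hε0 : ε ≠ 0 := by rcases hε with h | h <;> rw [h] <;> norm_num
  have htW0 : tW ≠ 0 := by
    rw [htW]
    exact div_ne_zero (mul_ne_zero hε0 hϖS) hden0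
  have hvε : padicValRat 3 ε = 0 := by
    rcases hε with h | h
    · rw [h, padicValRat.one]
    · rw [h, padicValRat.neg, padicValRat.one]
  have hvtW : padicValRat 3 tW = padicValRat 3 (ϖ' * S) - padicValRat 3 |(C.u : ℚ)| := by
    rw [htW, padicValRat.div (mul_ne_zero hε0 hϖS) hden0, padicValRat.mul hε0 hϖS,
      padicValRat.mul hua0 hcinf0, hvε, padicValRat_numRealComponents_eq_zero W 3 (by norm_num)]
    ring
  -- the constant terms: `L(0) = 2[0]⁺_f`, `Lω(0) = e S⁻`, `g(0) = u ϖ ϖ' L(0) Lω(0)`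
  have hL0 : ((PowerSeries.constantCoeff L : ℤ_[3]) : ℚ_[3]) = ((2 * sV : ℚ) : ℚ_[3]) :=
    hL.constantCoeff_eq_of_eq_one (by norm_num) hf hgood ha3
  have hg0 : ((PowerSeries.constantCoeff g : ℤ_[3]) : ℚ_[3]) =
      ((u : ℤ_[3]) : ℚ_[3]) * ((e : ℤ_[3]) : ℚ_[3]) * 2 * ((tV : ℚ) : ℚ_[3]) *
        ((ϖ' * S : ℚ) : ℚ_[3]) := by
    rw [← constantCoeff_iwasawaToPowerSeries 3 g, hιg]
    simp only [map_mul, PowerSeries.constantCoeff_C, constantCoeff_iwasawaToPowerSeries, hL0, hLω,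
      htV, hS]
    push_cast
    ring
  -- `g(0) = h(0) · fE(0)`
  have hg0' : (PowerSeries.constantCoeff g : ℤ_[3]) =
      PowerSeries.constantCoeff h * PowerSeries.constantCoeff fE := by
    rw [← hgh, map_mul]
  -- names
  set h0 : ℚ_[3] := ((PowerSeries.constantCoeff h : ℤ_[3]) : ℚ_[3]) with hh0
  set f0 : ℚ_[3] := ((PowerSeries.constantCoeff fE : ℤ_[3]) : ℚ_[3]) with hf0
  have htVQ : ((tV : ℚ) : ℚ_[3]) ≠ 0 := by exact_mod_cast htV0
  have hϖSQ : ((ϖ' * S : ℚ) : ℚ_[3]) ≠ 0 := by exact_mod_cast hϖS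
  have h2Q : (2 : ℚ_[3]) ≠ 0 := by exact_mod_cast (by norm_num : (2 : ℕ) ≠ 0)
  have hue0 : ((u : ℤ_[3]) : ℚ_[3]) * ((e : ℤ_[3]) : ℚ_[3]) * 2 ≠ 0 :=
    mul_ne_zero (mul_ne_zero (coe_units_ne_zero 3 u) (coe_units_ne_zero 3 e)) h2Q
  have hg0ne : PowerSeries.constantCoeff g ≠ 0 := by
    intro h0'
    have h' : ((u : ℤ_[3]) : ℚ_[3]) * ((e : ℤ_[3]) : ℚ_[3]) * 2 * ((tV : ℚ) : ℚ_[3]) *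
        ((ϖ' * S : ℚ) : ℚ_[3]) = 0 := by rw [← hg0, h0', PadicInt.coe_zero]
    exact mul_ne_zero (mul_ne_zero hue0 htVQ) hϖSQ h'
  have hfE0 : PowerSeries.constantCoeff fE ≠ 0 := by
    intro h0'
    apply hg0ne
    rw [hg0', h0', mul_zero]
  have hh0ne : h0 ≠ 0 := by
    rw [hh0]
    intro h0'
    apply hg0ne
    rw [hg0', (PadicInt.coe_eq_zero.mp h0'), zero_mul]
  have hf0ne : f0 ≠ 0 := by
    rw [hf0]
    exact fun h' ↦ hfE0 (PadicInt.coe_eq_zero.mp h')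
  -- CONTROL INEQUALITY (Kobayashi Lemma 9.1 + Kitajima–Otsuki + Greenberg Lemma 4.2):
  -- `ord₃ #Sel_{3^∞}(V_K) ≤ ord₃ fE(0)`
  obtain ⟨-, hctl⟩ := SignedControlZero.padicValNat_card_selmerGroupPInfty_le VK hγ D hX (hBK κ)
    (hnfK κ γ hκ hγ D hX) hchar' hfE0
  -- KEY identity in `ℚ₃`: `(u e 2) · t_V · (ϖ'S) = h(0) · fE(0)`
  have key : ((u : ℤ_[3]) : ℚ_[3]) * ((e : ℤ_[3]) : ℚ_[3]) * 2 * ((tV : ℚ) : ℚ_[3]) *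
        ((ϖ' * S : ℚ) : ℚ_[3]) = h0 * f0 := by
    rw [← hg0, hg0', hh0, hf0]; push_cast; ring
  -- valuations of `key`
  have hvue : (((u : ℤ_[3]) : ℚ_[3]) * ((e : ℤ_[3]) : ℚ_[3]) * 2).valuation = 0 := by
    rw [Padic.valuation_mul (mul_ne_zero (coe_units_ne_zero 3 u) (coe_units_ne_zero 3 e)) h2Q,
      Padic.valuation_mul (coe_units_ne_zero 3 u) (coe_units_ne_zero 3 e),
      valuation_coe_units_eq_zero, valuation_coe_units_eq_zero]
    have h2v : (2 : ℚ_[3]).valuation = 0 := by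
      have h := Padic.valuation_natCast (p := 3) 2
      rw [show padicValNat 3 2 = 0 by norm_num] at h
      exact_mod_cast h
    rw [h2v]; ring
  -- §A `ord₃ u(C) = 0` (`V` good at `3`, both models globally minimal)
  have hC3 : C • V.quadraticTwist (((-((3 : ℕ) : ℤ)) : ℤ) : ℚ) = W := by push_cast; exact hC
  have hu0 : padicValRat 3 (C.u : ℚ) = 0 :=
    padicValRat_u_eq_zero_of_twist_pm_p 3 (by norm_num) V W (Or.inl hgood) (Or.inr rfl) C hC3
  have hvuC : padicValRat 3 |(C.u : ℚ)| = 0 := by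
    rcases abs_choice (C.u : ℚ) with h | h
    · rw [h, hu0]
    · rw [h, padicValRat.neg, hu0]
  -- §B the quadratic Selmer comparison `Sel(V) × Sel(V^{(−3)}) ≅ Sel(V_K)` (bijective for `p = 3`)
  obtain ⟨θ₀, c, hθ₀, hc⟩ :=
    Literature.NumberTheory.QuadraticFields.Quadratic.exists_sq_eq_algebraMap (F := ℚ) (K := K) h2
  obtain ⟨q, hq0, hdq⟩ := NumberField.exists_discr_eq_mul_sq h2 hθ₀ hc
  set θ : K := algebraMap ℚ K q * θ₀ with hθdef
  have hθsq : θ ^ 2 = algebraMap ℚ K (-(3 : ℚ)) := by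
    rw [← hdK, hθdef, mul_pow, ← map_pow, hc, ← map_mul, hdq, mul_comm]
  have hθ : θ ∉ Set.range (algebraMap ℚ K) := fun ⟨r, hr⟩ ↦ hθ₀ ⟨r / q, by
    rw [map_div₀, hr, hθdef, mul_div_cancel_left₀ _ ((map_ne_zero _).mpr hq0)]⟩
  set Vt : WeierstrassCurve ℚ := V.quadraticTwist (-(3 : ℚ)) with hVt
  haveI hVtE : Vt.IsElliptic := V.isElliptic_quadraticTwist (by norm_num)
  haveI hEVt : Finite Vt.toAffine.Point := by
    have hEW' := hEW
    rw [← hC] at hEW'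
    exact Finite.of_equiv _ (VariableChange.pointEquiv Vt C).toEquiv.symm
  have hfinVt : Finite Vt.sha := (Equiv.finite_iff (shaEquiv Vt C)).mpr (by rw [hC]; exact hfinW)
  haveI : Finite Vt.sha := hfinVt
  set Φ := comparisonMap V K hθ hθsq 3 with hΦ
  have h83 : ∀ k : ℕ, Nat.Coprime 8 (3 ^ k) := fun k ↦
    (Nat.Coprime.pow_right k (by norm_num : Nat.Coprime 8 3))
  have hΦinj : Function.Injective Φ := by
    intro x y hxy
    have h0 : Φ (x - y) = 0 := by rw [map_sub, hxy, sub_self]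
    have h8 := nsmul_eq_zero_of_comparisonMap_eq_zero V K h2 hθ hθsq 3 (x - y) h0
    obtain ⟨k₁, hk₁⟩ := exists_pow_nsmul_eq_zero_galH1Primary V 3 ((x - y).1 : galH1Primary V 3)
    obtain ⟨k₂, hk₂⟩ := exists_pow_nsmul_eq_zero_galH1Primary Vt 3 ((x - y).2 : galH1Primary Vt 3)
    have hk : (3 ^ (k₁ + k₂)) • (x - y) = 0 := by
      refine Prod.ext (Subtype.ext ?_) (Subtype.ext ?_)
      · change (3 ^ (k₁ + k₂)) • ((x - y).1 : galH1Primary V 3) = 0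
        rw [pow_add, mul_comm, mul_smul, hk₁, smul_zero]
      · change (3 ^ (k₁ + k₂)) • ((x - y).2 : galH1Primary Vt 3) = 0
        rw [pow_add, mul_smul, hk₂, smul_zero]
    exact sub_eq_zero.mp
      (XGssCyclotomicThreeSharp.eq_zero_of_nsmul_eq_zero_of_coprime (h83 _) h8 hk)
  have hΦsurj : Function.Surjective Φ := by
    intro s
    obtain ⟨x, hx⟩ := nsmul_mem_range_comparisonMap V K h2 hθ hθsq 3 s
    obtain ⟨k, hk⟩ := exists_pow_nsmul_eq_zero_galH1Primary VK 3 (s : galH1Primary VK 3)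
    have hk' : (3 ^ k) • s = 0 := Subtype.ext (by
      rw [AddSubmonoidClass.coe_nsmul, ZeroMemClass.coe_zero]; exact hk)
    obtain ⟨a, ha⟩ := XGssCyclotomicThreeSharp.exists_zsmul_nsmul_eq_of_coprime (h83 k) hk'
    exact ⟨a • x, by rw [map_zsmul, hx, ha]⟩
  have hcardSel : Nat.card (VK.selmerGroupPInfty 3) =
      Nat.card (V.selmerGroupPInfty 3) * Nat.card (Vt.selmerGroupPInfty 3) := by
    rw [← Nat.card_prod]
    exact (Nat.card_congr (Equiv.ofBijective Φ ⟨hΦinj, hΦsurj⟩)).symm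
  -- §C Selmer = Ш[3^∞] in rank 0, and `#Ш(V^{(−3)}) = #Ш(W)`
  have hSelV : Nat.card (V.selmerGroupPInfty 3) = Nat.card (AddCommGroup.primaryComponent V.sha 3) :=
    V.natCard_selmerGroupPInfty_eq_natCard_primaryComponent_sha 3
  have hSelVt : Nat.card (Vt.selmerGroupPInfty 3) = Nat.card (AddCommGroup.primaryComponent Vt.sha 3) :=
    Vt.natCard_selmerGroupPInfty_eq_natCard_primaryComponent_sha 3
  have hShaVt : Vt.shaOrder = W.shaOrder := by
    have h := shaOrder_variableChange_holds Vt C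
    rw [shaOrder_variableChange, hC] at h
    exact h.symm
  have hposV : 0 < Nat.card (V.selmerGroupPInfty 3) := by rw [hSelV]; exact Nat.card_pos
  have hposVt : 0 < Nat.card (Vt.selmerGroupPInfty 3) := by rw [hSelVt]; exact Nat.card_pos
  have hvSelK : (padicValNat 3 (Nat.card (VK.selmerGroupPInfty 3)) : ℤ) =
      (padicValNat 3 V.shaOrder : ℤ) + padicValNat 3 W.shaOrder := by
    rw [hcardSel, padicValNat.mul hposV.ne' hposVt.ne', hSelV, hSelVt,
      padicValNat_card_addPrimaryComponent 3, padicValNat_card_addPrimaryComponent 3, ← hShaVt]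
    push_cast
    rfl
  -- §D valuations: `ord₃#Ш(V) + ord₃#Ш(W) ≤ v(fE(0)) ≤ v(t_V) + v(ϖ'S)`
  have hval := congrArg Padic.valuation key
  rw [Padic.valuation_mul (mul_ne_zero hue0 htVQ) hϖSQ, Padic.valuation_mul hue0 htVQ, hvue,
    Padic.valuation_ratCast, Padic.valuation_ratCast, Padic.valuation_mul hh0ne hf0ne] at hval
  have hh0val : 0 ≤ h0.valuation := by
    rw [hh0]
    exact PadicInt.valuation_coe_nonneg
  have hI : (padicValNat 3 V.shaOrder : ℤ) + padicValNat 3 W.shaOrder ≤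
      padicValRat 3 tV + padicValRat 3 (ϖ' * S) := by
    rw [hvSelK] at hctl
    rw [← hf0] at hctl
    linarith
  -- conclusion
  have hSV0 : (V.shaOrder : ℚ) ≠ 0 := by exact_mod_cast (V.shaOrder_pos hfinV).ne'
  have hSW0 : (W.shaOrder : ℚ) ≠ 0 := by exact_mod_cast (W.shaOrder_pos hfinW).ne'
  have hcV0 : (V.tamagawaProduct : ℚ) ≠ 0 := by exact_mod_cast V.tamagawaProduct_pos_holds.ne'
  have hcW0 : (W.tamagawaProduct : ℚ) ≠ 0 := by exact_mod_cast W.tamagawaProduct_pos_holds.ne'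
  have hNV0 : ((Nat.card V.toAffine.Point : ℕ) : ℚ) ≠ 0 := by exact_mod_cast Nat.card_pos.ne'
  have hNW0 : ((Nat.card W.toAffine.Point : ℕ) : ℚ) ≠ 0 := by exact_mod_cast Nat.card_pos.ne'
  refine ⟨tV * (Nat.card V.toAffine.Point : ℚ) ^ 2 / (V.tamagawaProduct : ℚ),
    tW * (Nat.card W.toAffine.Point : ℚ) ^ 2 / (W.tamagawaProduct : ℚ), hshaV, hshaW, ?_⟩
  rw [padicValRat.div (mul_ne_zero htV0 (pow_ne_zero 2 hNV0)) hcV0,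
    padicValRat.mul htV0 (pow_ne_zero 2 hNV0), padicValRat.pow, padicValRat.of_nat, padicValRat.of_nat,
    padicValRat.div (mul_ne_zero htW0 (pow_ne_zero 2 hNW0)) hcW0,
    padicValRat.mul htW0 (pow_ne_zero 2 hNW0), padicValRat.pow, padicValRat.of_nat, padicValRat.of_nat,
    hvtW, hvuC]
  push_cast at hI ⊢
  linarith

end Core

end Summit.BirchSwinnertonDyer.Rank1Residual.Additive

end
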